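import Summits.CriticalPhenomena.PercolationContinuityZ3.Theorems.PercNearOneGluingNoHeavyConstsHardCoreHarrisMeasure
import HarnessLib

/-!
# Hard-core Harris / two-copy BHK at measure level — PRODUCT-MEASURE forms (two independent copies as `μ ⊗ μ`)

Support file (prover prim-facecert gen 14; `--supports stmt-CriticalPhenomena-4575`); builds on the lead seat
prim-nh-lead-4575's gen-105 programme (memo `run/shared/lean/prim/prim-nh-lead-4575/LEAD-GEN105.md` §1(6): conjecture (HC)
"hard-core Harris", its reduction to PA-BERN = `Consts.FibrewiseBHK`, and the pencil proof of the MEASURE-LEVEL two-copy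
statement by an averaging-operator iteration; `|N| = 1` in the kernel: `…ConstsHardCoreHarrisOne`).  No definitions, no named
facts, no sorries; standard axioms.

The theorems of `…ConstsHardCoreHarrisMeasure` are stated as double finite sums against the product weights
`w(ω)·w(ω')` (= two independent copies).  This file restates the headline inequality for the genuine product measure
`(prodBernoulli w).prod (prodBernoulli w)` by Fubini on the finite configuration space:
* `integral_prod_eq_sum_sum`, `prod_real_eq_sum_sum` — `∫ X d(μ⊗μ) = ΣΣ w(ω)w(ω') X(ω,ω')`, `(μ⊗μ)(A) = ΣΣ w w' 1_A`;
* `hardCoreHarris_prodMeasure` — `∫ Z·F(C_S(ω))·G(C_S(ω')) d(μ⊗μ) ≤ ∫ Z·F(C_S(ω))·G(C_S(ω)) d(μ⊗μ)`,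
  `Z = 1_D(ω)1_D(ω')1{no v ∈ N joined to S in both copies}`, `F, G` monotone;
* `hardCoreHarris_prodMeasure_event` — for increasing cluster predicates `P, Q`:
  `(μ⊗μ){ω,ω' ∈ D, HC_N, P(C_S ω), Q(C_S ω')} ≤ (μ⊗μ){ω,ω' ∈ D, HC_N, P(C_S ω), Q(C_S ω)}` — the measure-level shadow, for EVERY
  `N` and `T`, of the fibrewise conjecture `Consts.HardCoreBHK` (`|N| = 1`, `T = ∅`: `Consts.hardCoreHarris_measure_one`).  [this work]
[cite: VandenbergHaggstromKahn2005, Thm. 1.3 (p. 6), Thm. 2.1 (p. 9) at q = 1]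
-/

noncomputable section

namespace Summit.CriticalPhenomena.PercolationContinuityZ3.Theorems

namespace TwoCopyHardCore

open MeasureTheory Set Finset
open Literature.Probability.LatticeModels (prodBernoulli)
open Literature.Probability.Percolation
open Literature.Probability.Percolation.BHK2006
open DecisionTree (ind ind_of_mem ind_of_not_mem ind_nonneg)
open scoped Classical

variable {V : Type*} [Fintype V]

/-! ### Product-measure forms (two independent copies as `μ.prod μ`) -/

section ProductMeasure

variable (w : Sym2 V → unitInterval) (S T N : Set V)
  {D : Set (BondConfig V)} (hD : ∀ ω, ω ∈ D ↔ ∀ s ∈ S, ∀ t ∈ T, ¬ (openGraph ω).Reachable s t)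

omit [Fintype V] in
/-- A double finite sum against the product weights is an integral against the product measure `μ.prod μ`,
`μ = prodBernoulli w` (Fubini on a finite space + `integral_prodBernoulli_eq_sum`). [folklore] -/
theorem integral_prod_eq_sum_sum [Fintype V] (X : BondConfig V → BondConfig V → ℝ) :
    ∫ π, X π.1 π.2 ∂((prodBernoulli w).prod (prodBernoulli w)) =
      ∑ ω, ∑ ω', weight (fun e => (w e : ℝ)) ω * weight (fun e => (w e : ℝ)) ω' * X ω ω' := by
  rw [integral_prod _ Integrable.of_finite]
  simp only [integral_prodBernoulli_eq_sum]
  exact Finset.sum_congr rfl fun ω _ => by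
    rw [Finset.mul_sum]; exact Finset.sum_congr rfl fun ω' _ => by ring

include hD in
/-- **Hard-core Harris, product-measure form.**  For two independent copies `(ω, ω') ~ μ.prod μ`, `μ = prodBernoulli w`,
`Z = 1_D(ω)1_D(ω')·1{no v ∈ N is joined to S in both copies}` and monotone `F, G` of the union cluster:
`∫ Z·F(C_S(ω))·G(C_S(ω')) d(μ⊗μ) ≤ ∫ Z·F(C_S(ω))·G(C_S(ω)) d(μ⊗μ)` — `hardCoreHarris_measure` via Fubini. [this work] -/
theorem hardCoreHarris_prodMeasure (F G : Set (Sym2 V) → ℝ) (hF : Monotone F) (hG : Monotone G) :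
    ∫ π, (ind D π.1 * ind D π.2 *
        (if ∀ v ∈ N, ¬ ((∃ s ∈ S, (openGraph π.1).Reachable s v) ∧ ∃ s ∈ S, (openGraph π.2).Reachable s v)
          then (1 : ℝ) else 0)) *
      (F (⋃ s ∈ S, openEdgeCluster π.1 s) * G (⋃ s ∈ S, openEdgeCluster π.2 s))
      ∂((prodBernoulli w).prod (prodBernoulli w)) ≤
    ∫ π, (ind D π.1 * ind D π.2 *
        (if ∀ v ∈ N, ¬ ((∃ s ∈ S, (openGraph π.1).Reachable s v) ∧ ∃ s ∈ S, (openGraph π.2).Reachable s v)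
          then (1 : ℝ) else 0)) *
      (F (⋃ s ∈ S, openEdgeCluster π.1 s) * G (⋃ s ∈ S, openEdgeCluster π.1 s))
      ∂((prodBernoulli w).prod (prodBernoulli w)) := by
  have h := hardCoreHarris_measure w S T N hD F G hF hG
  rw [integral_prod_eq_sum_sum w (fun ω ω' => (ind D ω * ind D ω' *
        (if ∀ v ∈ N, ¬ ((∃ s ∈ S, (openGraph ω).Reachable s v) ∧ ∃ s ∈ S, (openGraph ω').Reachable s v)
          then (1 : ℝ) else 0)) * (F (⋃ s ∈ S, openEdgeCluster ω s) * G (⋃ s ∈ S, openEdgeCluster ω' s))),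
    integral_prod_eq_sum_sum w (fun ω ω' => (ind D ω * ind D ω' *
        (if ∀ v ∈ N, ¬ ((∃ s ∈ S, (openGraph ω).Reachable s v) ∧ ∃ s ∈ S, (openGraph ω').Reachable s v)
          then (1 : ℝ) else 0)) * (F (⋃ s ∈ S, openEdgeCluster ω s) * G (⋃ s ∈ S, openEdgeCluster ω s)))]
  simpa only [mul_assoc] using h

/-- The product measure of a set of pairs as a double finite sum. [folklore] -/
theorem prod_real_eq_sum_sum (A : Set (BondConfig V × BondConfig V)) :
    ((prodBernoulli w).prod (prodBernoulli w)).real A =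
      ∑ ω, ∑ ω', weight (fun e => (w e : ℝ)) ω * weight (fun e => (w e : ℝ)) ω' *
        (if (ω, ω') ∈ A then (1 : ℝ) else 0) := by
  rw [← integral_indicator_one MeasurableSet.of_discrete,
    ← integral_prod_eq_sum_sum w (fun ω ω' => if (ω, ω') ∈ A then (1 : ℝ) else 0)]
  refine integral_congr_ae (Filter.Eventually.of_forall fun π => ?_)
  simp only [Set.indicator_apply, Pi.one_apply, Prod.mk.eta]

include hD in
/-- **Hard-core Harris for EVENTS, product-measure form** (the measure-level shadow of the fibrewise conjecture
`Consts.HardCoreBHK`, for every hard-core set `N` and repelled set `T`): for increasing cluster predicates `P, Q` and two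
independent copies `(ω, ω') ~ μ ⊗ μ`,
`(μ⊗μ){ω ∈ D, ω' ∈ D, HC_N, P(C_S ω), Q(C_S ω')} ≤ (μ⊗μ){ω ∈ D, ω' ∈ D, HC_N, P(C_S ω), Q(C_S ω)}`.  [this work] -/
theorem hardCoreHarris_prodMeasure_event (P Q : Set (Sym2 V) → Prop)
    (hP : ∀ ⦃C C' : Set (Sym2 V)⦄, C ⊆ C' → P C → P C')
    (hQ : ∀ ⦃C C' : Set (Sym2 V)⦄, C ⊆ C' → Q C → Q C') :
    ((prodBernoulli w).prod (prodBernoulli w)).real {π : BondConfig V × BondConfig V | π.1 ∈ D ∧ π.2 ∈ D ∧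
        (∀ v ∈ N, ¬ ((∃ s ∈ S, (openGraph π.1).Reachable s v) ∧ ∃ s ∈ S, (openGraph π.2).Reachable s v)) ∧
        P (⋃ s ∈ S, openEdgeCluster π.1 s) ∧ Q (⋃ s ∈ S, openEdgeCluster π.2 s)} ≤
    ((prodBernoulli w).prod (prodBernoulli w)).real {π : BondConfig V × BondConfig V | π.1 ∈ D ∧ π.2 ∈ D ∧
        (∀ v ∈ N, ¬ ((∃ s ∈ S, (openGraph π.1).Reachable s v) ∧ ∃ s ∈ S, (openGraph π.2).Reachable s v)) ∧
        P (⋃ s ∈ S, openEdgeCluster π.1 s) ∧ Q (⋃ s ∈ S, openEdgeCluster π.1 s)} := by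
  -- the real indicators of `P`, `Q` as monotone functions of the cluster
  have hF : Monotone (fun C : Set (Sym2 V) => if P C then (1 : ℝ) else 0) := by
    intro C C' hCC'
    by_cases h : P C
    · simp only [if_pos h, if_pos (hP hCC' h), le_refl]
    · simp only [if_neg h]; split_ifs <;> norm_num
  have hG : Monotone (fun C : Set (Sym2 V) => if Q C then (1 : ℝ) else 0) := by
    intro C C' hCC'
    by_cases h : Q C
    · simp only [if_pos h, if_pos (hQ hCC' h), le_refl]
    · simp only [if_neg h]; split_ifs <;> norm_num
  have h := hardCoreHarris_measure w S T N hD _ _ hF hG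
  have hind : ∀ (X : Set (BondConfig V)) (ω : BondConfig V), (if ω ∈ X then (1 : ℝ) else 0) = ind X ω := by
    intro X ω; by_cases hω : ω ∈ X
    · rw [if_pos hω, ind_of_mem hω]
    · rw [if_neg hω, ind_of_not_mem hω]
  -- `1{p ∧ q} = 1{p}·1{q}` (inlined; the tree has this as `…GhostGaugeLaw.ite_and_one` in an unrelated summit)
  have ite_and_one_zero : ∀ (p q : Prop) [Decidable p] [Decidable q],
      (if p ∧ q then (1 : ℝ) else 0) = (if p then (1 : ℝ) else 0) * (if q then (1 : ℝ) else 0) := by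
    intro p q _ _
    by_cases hp : p <;> by_cases hq : q <;> simp [hp, hq]
  rw [prod_real_eq_sum_sum, prod_real_eq_sum_sum]
  simp only [mem_setOf_eq, ite_and_one_zero, hind]
  refine le_of_le_of_eq (le_of_eq_of_le ?_ h) ?_
  · exact Finset.sum_congr rfl fun ω _ => Finset.sum_congr rfl fun ω' _ => by ring
  · exact Finset.sum_congr rfl fun ω _ => Finset.sum_congr rfl fun ω' _ => by ring

end ProductMeasure

end TwoCopyHardCore

end Summit.CriticalPhenomena.PercolationContinuityZ3.Theorems
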